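import Mathlib
import HarnessLib
import Summits.NavierStokesRegularity.NavierStokesRegularity.Theorems.UnthreadedDoorNetFluxDefs

/-!
# Route `UnthreadedDoor`, crux `PoloidalLiouville` (stmt-NavierStokesRegularity-1222), WALL W1 `stub_scalarLiouville` —
# crux idea «netflux-typei-gap» (planner ns-idea-14 g3; ns-wall-crit-1 V8/V12): THE TYPED OBJECTS AND HINGE STATEMENTS
# of the registered LINE file (Theorems-side twin of `Cruxes/PoloidalLiouville/Lines/netflux_typei_gap.lean` §0)

Definition file, the companion of `…UnthreadedDoorNetFluxDefs` (p660450, twin of the SKETCH): Theorems-side twin of §0 of the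
LINE file `Cruxes/PoloidalLiouville/Lines/netflux_typei_gap.lean` (ns-idea-14 g3, «NETFLUX LINE v3», tree sha12 7e39e32c27b6),
namespace `…Theorems.PoloidalLiouville.NetFlux` instead of the line's `…Cruxes.PoloidalLiouville.NetFlux`; the def BODIES are
VERBATIM (single source of truth per ns-wall-crit-1 V12 P4: this file copies, it does not restate).  Purpose: the envelope
toolkit for NF-1b (`…UnthreadedDoorNetFluxEnvelopeToolkit`, KEY-NS #156) and later NF-1a/NF-1c landings can be stated BY NAME
from Theorems/ (Cruxes files are not importable there).

Objects: `sphArgmax`, `sphArgmin` (spherical argmax / argmin sets), `radDeriv`, `radDeriv2` (radial derivatives about `x₀`),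
`supEnvDefect` (the upper envelope defect, INF over the argmax of the radial heat defect).
Statements: `SupEnvelopeLaw` (NF-1b, V8 P1 hinge (b)), `ExtremalHeadEMF` (NF-1a, hinge (a)), `RadialOfNetFluxLeZero` (NF-5; PROVED
inside the line file by ns-idea-14 g3 — copied here only so that Theorems-side users have the name).

WHAT THIS IS NOT: no NS-regularity statement is touched; `PoloidalLiouville` (1222), its wall `stub_scalarLiouville` and the
line's rung target `UnimodalScalarLiouvilleTypeI` stay OPEN; these are the objects of one crux idea.
`--supports stmt-NavierStokesRegularity-1222 --as helper`.  Author of the statements: planner ns-idea-14; filed Theorems-side by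
ns-qj-p1 g4 (KEY-NS #156).  [folklore]
-/

noncomputable section

-- the summit and its single sub-problem share the name (CONVENTIONS §1)
set_option linter.dupNamespace false

namespace Summit.NavierStokesRegularity.NavierStokesRegularity.Theorems.PoloidalLiouville.NetFlux

open Set Function Filter Topology MeasureTheory
open scoped RealInnerProductSpace
open Literature.Analysis.FluidPDE

/-! ### §0 of the line file: spherical argmax/argmin, radial derivatives, the upper envelope defect -/

/-- `argmax_{S_r(x₀)} f` (nonempty compact for `r > 0`, `f` continuous on the sphere). -/
def sphArgmax (f : E3 → ℝ) (x₀ : E3) (r : ℝ) : Set E3 :=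
  {x : E3 | x ∈ Metric.sphere x₀ r ∧ ∀ y ∈ Metric.sphere x₀ r, f y ≤ f x}

/-- `argmin_{S_r(x₀)} f`. -/
def sphArgmin (f : E3 → ℝ) (x₀ : E3) (r : ℝ) : Set E3 :=
  {x : E3 | x ∈ Metric.sphere x₀ r ∧ ∀ y ∈ Metric.sphere x₀ r, f x ≤ f y}

/-- Radial derivative `∂_r f (x)` (`x ≠ x₀`, along the unit vector `(x − x₀)/‖x − x₀‖`). -/
def radDeriv (f : E3 → ℝ) (x₀ x : E3) : ℝ :=
  deriv (fun ρ : ℝ => f (x₀ + ρ • (‖x - x₀‖⁻¹ • (x - x₀)))) ‖x - x₀‖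

/-- Second radial derivative `∂_r² f (x)`. -/
def radDeriv2 (f : E3 → ℝ) (x₀ x : E3) : ℝ :=
  iteratedDeriv 2 (fun ρ : ℝ => f (x₀ + ρ • (‖x - x₀‖⁻¹ • (x - x₀)))) ‖x - x₀‖

/-- The upper envelope defect: `inf over argmax_{S_r} T(t)` of the radial heat defect
`T_t − T_rr − (2/r) T_r` (INF, not sup: at Danskin points every maximiser realises `∂_t, ∂_r` of the
envelope and bounds its second `r`-derivative from below, so the best maximiser may be used). -/
def supEnvDefect (T : ℝ → E3 → ℝ) (x₀ : E3) (t r : ℝ) : ℝ :=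
  sInf ((fun x => deriv (fun s => T s x) t - radDeriv2 (T t) x₀ x - (2 / r) * radDeriv (T t) x₀ x)
        '' sphArgmax (T t) x₀ r)

/-- **(NF-1b, V8 P1 hinge (b), M) Envelope law for the spherical maximum — pure analysis, no PDE.**
For `T` smooth on `(t₀,0) × (ℝ³ ∖ {x₀})`, `F(t,r) := r · max_{S_r(x₀)} T(t)` is locally Lipschitz and locally
semiconvex in `(t,r)` on `(t₀,0) × (0,∞)` (a max over the FIXED parameter set `S²` of uniformly `C²` functions),
Danskin gives `∂_t F = r T_t(x⁺)`, `∂_r F = T⁺ + r T_r(x⁺)` for EVERY maximiser at a.e. `(t,r)`, and touching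
from below by `r' ↦ r' T(t, x₀ + r'ξ⁺)` gives `(∂_r² F)_{ac} ≥ r T_rr(x⁺) + 2 T_r(x⁺)`; the singular part of
`∂_r² F` is `≥ 0`.  Hence `(∂_t − ∂_r²) F ≤ r · supEnvDefect` in `𝒟′`, i.e. for smooth compactly supported
`ψ ≥ 0` in `(t₀,0) × (0,∞)`:  `0 ≤ ∬ F (ψ_t + ψ_rr) + r · supEnvDefect · ψ`.
Boundedness / continuity of `T` AT `x₀` is not used (test functions live in `r > 0`).  The law for the
spherical minimum is this one applied to `−T`. -/
def SupEnvelopeLaw : Prop :=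
  ∀ (T : ℝ → E3 → ℝ) (x₀ : E3) (t₀ : ℝ),
    ContDiffOn ℝ (⊤ : ℕ∞) (uncurry T) (Ioo t₀ 0 ×ˢ ({x₀}ᶜ : Set E3)) →
    ∀ ψ : ℝ → ℝ → ℝ, ContDiff ℝ (⊤ : ℕ∞) (uncurry ψ) → HasCompactSupport (uncurry ψ) →
      tsupport (uncurry ψ) ⊆ Ioo t₀ 0 ×ˢ Ioi 0 → (∀ t r, 0 ≤ ψ t r) →
      0 ≤ ∫ t, ∫ r, (r * sphSup (T t) x₀ r * (deriv (fun s => ψ s r) t + iteratedDeriv 2 (ψ t) r)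
                      + r * supEnvDefect T x₀ t r * ψ t r)

/-- **(NF-1a, V8 P1 hinge (a), M) Extremal head values and the EMF bound on saddle-free spheres.**
Data: `v, T` smooth on a window (`T` off the centre), a `C¹` head `P(t,·)` off `x₀` with TANGENTIAL relation
`∇P − m ∇T ∥ (x − x₀)`, `m = ⟪v, x − x₀⟫` (this is what `Theorems.PoloidalLiouville.CapSym.headPotentialExists`
delivers from (E1)), `‖v(t,·)‖ ≤ V(t)`, every sphere saddle-free (`IsUnimodalSphere`).  THEN the extremal head
difference `I(t,r) := P(t,x⁺) − P(t,x⁻)` is (i) independent of the choice of `x⁺ ∈ argmax_{S_r} T(t)`,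
`x⁻ ∈ argmin`, (ii) jointly continuous, (iii) locally Lipschitz in `r > 0`, (iv) `|I| ≤ V · r · osc = V · netFlux`,
(v) for a.e. `r`, `∂_r I ≤ sup_{argmax} ∂_r P − inf_{argmin} ∂_r P`.
PROOF ROUTE (planner g3; `P ∈ C¹` suffices — no Sard for `P`, no monotone paths, no Whitney pathology):
(α) existence of `P` with `∇_S P = m ∇_S T` forces `∇_S m ∥ ∇_S T`, so `m` is CONSTANT (`=: m̄(c)`) on every
regular level curve of `T|_{S_r}`, and `P` is constant there too; (β) on a saddle-free sphere every regular level
set `{T = c}` is ONE circle separating `{T > c}` from `{T < c}` (two circles would disconnect a sub- or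
super-level set); (γ) for ANY `C¹` path `γ` on `S_r`, `P(γ(1)) − P(γ(0)) = ∫_γ m dT = ∫ m̄(c) · ι(γ,c) dc`
(1-D area formula in `c`; Sard for the smooth `T|_{S_r}`; `ι` = algebraic crossing number of `γ` with the
circle `{T = c}`), and `ι = 1` for `T⁻ < c < T⁺` when `γ` runs from `argmin` to `argmax`, `ι = 0` when both
ends are maximisers.  Hence (i) and `I = ∫_{T⁻}^{T⁺} m̄(c) dc`, so (iv) from `|m̄| ≤ rV`; (ii) by dominated
convergence (`m̄(t,r,c)` is continuous at regular `(t,r,c)`, bounded); (iii) and (v) by comparing spheres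
`r, r'` along radially scaled paths: the end corrections are `∫_{T(r',x₀+r'ξ^±)}^{T^±(r')} m̄`, of size
`≤ r'V · |T^±(r') − T(r', x₀ + r'ξ^±(r))| = O(|r'−r|)` (Lipschitz) and `= o(|r'−r|)` at Danskin points of `T^±`
(where `∂_r T^± = ∂_r T(x^±)` for every extremiser), which gives `∂_r I = ∂_r P(x⁺) − ∂_r P(x⁻)` for EVERY
choice, a.e.  This is where «max-exchange» pathologies are shown ABSENT under unimodality. -/
def ExtremalHeadEMF : Prop :=
  ∀ (v : ℝ → E3 → E3) (x₀ : E3) (T P : ℝ → E3 → ℝ) (V : ℝ → ℝ) (t₀ : ℝ),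
    ContDiffOn ℝ (⊤ : ℕ∞) (uncurry v) (Ioo t₀ 0 ×ˢ univ) →
    ContDiffOn ℝ (⊤ : ℕ∞) (uncurry T) (Ioo t₀ 0 ×ˢ ({x₀}ᶜ : Set E3)) →
    (∀ t ∈ Ioo t₀ 0, ContDiffOn ℝ 1 (P t) ({x₀}ᶜ : Set E3)) →
    (∀ t ∈ Ioo t₀ 0, ∀ x, ‖v t x‖ ≤ V t) →
    (∀ t ∈ Ioo t₀ 0, ∀ x, x ≠ x₀ →
        cross (gradient (P t) x - (inner ℝ (v t x) (x - x₀)) • gradient (T t) x) (x - x₀) = 0) →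
    (∀ t ∈ Ioo t₀ 0, ∀ r > 0, IsUnimodalSphere (T t) x₀ r) →
    ∃ I : ℝ → ℝ → ℝ,
      (∀ t ∈ Ioo t₀ 0, ∀ r > 0, ∀ xp ∈ sphArgmax (T t) x₀ r, ∀ xm ∈ sphArgmin (T t) x₀ r,
          I t r = P t xp - P t xm) ∧
      ContinuousOn (uncurry I) (Ioo t₀ 0 ×ˢ Ioi 0) ∧
      (∀ t ∈ Ioo t₀ 0, ∀ a b : ℝ, 0 < a → a < b → ∃ L : NNReal, LipschitzOnWith L (I t) (Icc a b)) ∧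
      (∀ t ∈ Ioo t₀ 0, ∀ r > 0, |I t r| ≤ V t * netFlux (T t) x₀ r) ∧
      (∀ t ∈ Ioo t₀ 0, ∀ᵐ r : ℝ, 0 < r →
          deriv (I t) r ≤ sSup (radDeriv (P t) x₀ '' sphArgmax (T t) x₀ r)
                          - sInf (radDeriv (P t) x₀ '' sphArgmin (T t) x₀ r))

/-- **(NF-5, V8 P3's two S-lemmas merged, S) Vanishing cumulative net flux forces a radial potential.**
For `T ∈ C¹(ℝ³ ∖ {x₀})` bounded: `r ↦ osc_{S_r} T` is continuous on `r > 0` (compact spheres), `netFlux ≥ 0`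
is bounded on `(0,R)`, so `∫₀ᴿ netFlux ≤ 0` for all `R` forces `osc_{S_r} T = 0` for every `r > 0`, i.e. `T`
is constant on spheres, i.e. `∇T ∥ (x − x₀)`.  (Boundedness of `T` is needed: for `T = g(ξ)/r²` the integral
is junk-zero.)  At `x = x₀` the conclusion is `cross _ 0 = 0`. -/
def RadialOfNetFluxLeZero : Prop :=
  ∀ (T : E3 → ℝ) (x₀ : E3), ContDiffOn ℝ 1 T ({x₀}ᶜ : Set E3) → (∃ C : ℝ, ∀ x, |T x| ≤ C) →
    (∀ R > 0, ∫ r in Ioo 0 R, netFlux T x₀ r ≤ 0) → ∀ x, cross (gradient T x) (x - x₀) = 0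


end Summit.NavierStokesRegularity.NavierStokesRegularity.Theorems.PoloidalLiouville.NetFlux

end
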